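import Literature.MathematicalPhysics.QuantumFieldTheory.BalabanImbrieJaffe1984to88.BIJ88Eq242HiggsCovarianceTorus
import Literature.MathematicalPhysics.QuantumFieldTheory.BalabanImbrieJaffe1984to88.BIJ88Eq248Lattice

/-!
# `BalabanImbrieJaffe1984to88.BIJ88Eq248HiggsCovarianceTorus` — T. Bałaban, J. Imbrie, A. Jaffe, *Effective action and cluster properties of the
abelian Higgs model*, Commun. Math. Phys. **114** (1988) 257–315 [BalabanImbrieJaffe1988], §2 p. 265 [PDF 9], (2.48):
**THE `Λ`-INDEPENDENCE OF THE LOCAL PART, *"neither does C^{(k)}_{Λ,loc}(u; x₁, x₂) depend on Λ if dist({x₁, x₂}, Λ^c) > ½r(e_k). In this case we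
write it as C^{(k)}_{loc}(u; x₁, x₂) = C^{(k)}_{Λ,loc}(u; x₁, x₂), Λ large enough. (2.48)"*, FOR THE CHARTED REALIFIED TORUS OPERATORS OF GEN 23**
(`reOp Λ H` = gen 18's realification of the Dirichlet restriction `H|_Λ`, re-indexed to p13's `B4.Idx Λ′ 2`; `H` = the model's
`Δ_{k,loc}(u) + κP(u_k)` or any operator on `ℓ²(T^{(k)})`): the charted operator of `H|_Λ` IS the [6]-compression of the charted operator of
`H|_Ω` for `Λ ⊆ Ω ⊆ T^{(k)}` (`compress_reOp`), so p13's `BIJ88Eq248Lattice.cLoc_eq_cLoc_of_far` (proved for the `ℤ^d` operators of [6], ANY `A`,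
termwise) applies BY NAME: for two regions `Λ₁, Λ₂ ⊆ Ω` containing `x₁, x₂` with `x₁` at chart distance `> (ρ + 2)M` from `Ω ∖ Λ_i`, the local parts
of the walk expansions of `(H|_{Λ₁})^{−1}` and `(H|_{Λ₂})^{−1}` at `(x₁, x₂)` coincide (`cLoc_reOp_eq_of_far`), and the `X`-parts of
`(H|_Ω)^{−1}` and `(H|_Λ)^{−1}` coincide under p13's `XFar` (`cX_reOp_eq_of_far`).

statement-level skeleton of published theorems with citation tags; proofs where landed; nothing here is a claim about the Yang–Mills mass gap

HONEST SCOPE.  Both clauses of (2.48): the local part (`cLoc_reOp_eq_of_far`, two volumes `Λ₁, Λ₂ ⊆ Ω`) and the `X`-parts (`cX_reOp_eq_of_far`,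
`Λ ⊆ Ω`, with p13's `XFar` hypothesis on the charted labels exactly as p13 states it).  Distances in the chart sup-distance of
gen 23 (`cdist`, = torus distance inside a half-torus box); `M ≥ 1`, any `ρ` (print `ρM = ¼r(e_k)`, threshold `(ρ+2)M ≈ ½r(e_k)`); realified
coordinates; termwise (no (5.6), no convergence).  Imports: gen 23 `BIJ88Eq242HiggsCovarianceTorus`, p13 `BIJ88Eq248Lattice`.  Literature +
Mathlib only.  Unit `lit-balaban-p31` (literature-prover-lit-balaban-p31-g23-0), 2026-08-23.  NOT summit progress.
-/

open scoped BigOperators Matrix ComplexConjugate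
open Finset Matrix

namespace Literature.MathematicalPhysics.QuantumFieldTheory.BalabanImbrieJaffe1984to88.BIJ88Eq248HiggsCovarianceTorus

open Literature.MathematicalPhysics.QuantumFieldTheory.Balaban1983to89
open BIJ88Eq240FlatTorus (realify compress)
open BIJ88RandomWalk242 BIJ88Eq242Lattice BIJ88Ineq246Lattice B4Sect5CubeBounds
open BIJ88Eq248Lattice (FarFromCompl XFar eCube cLoc_eq_cLoc_of_far cX_eq_of_far)
open BIJ88Eq242HiggsCovarianceTorus (chart chartEmb chartSet idxEquiv reOp reOp_apply coe_idxEquiv_fst cdist)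

noncomputable section

variable {P : Params} {j : ℕ}

/-- the chart of a sub-region is a sub-region of the chart. [cite: BalabanImbrieJaffe1988, (2.48) p.265] -/
theorem chartSet_mono {Λ Ω : Finset (Balaban1983to89.Site P j)} (h : Λ ⊆ Ω) : chartSet Λ ⊆ chartSet Ω := Finset.map_subset_map.2 h

/-- a charted site of `Ω` outside the chart of `Λ` comes from a site of `Ω ∖ Λ`. [cite: BalabanImbrieJaffe1988, (2.48) p.265] -/
theorem farFromCompl_chart {Λ Ω : Finset (Balaban1983to89.Site P j)} {M : ℕ} {ρ : ℝ} {x : Balaban1983to89.Site P j}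
    (hfar : ∀ y ∈ Ω, y ∉ Λ → (ρ + 2) * M < cdist x y) : FarFromCompl M (chartSet Ω) (chartSet Λ) ρ (chart x) := by
  intro z hz hzΛ
  obtain ⟨y, hy, rfl⟩ := Finset.mem_map.1 hz
  have hyΛ : y ∉ Λ := fun h => hzΛ (Finset.mem_map_of_mem chartEmb h)
  exact hfar y hy hyΛ

/-- **the charted operator of `H|_Λ` is the [6]-compression (`A_Λ = ΛAΛ`) of the charted operator of `H|_Ω`**, `Λ ⊆ Ω` — so p13's `ℤ^d`
theorems about Dirichlet compressions apply to gen 23's torus operators. [cite: BalabanImbrieJaffe1988, (2.39) p.264, (2.48) p.265] -/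
theorem compress_reOp {Λ Ω : Finset (Balaban1983to89.Site P j)} (h : Λ ⊆ Ω)
    (H : Matrix (Balaban1983to89.Site P j) (Balaban1983to89.Site P j) ℂ) : B4.compress (chartSet_mono h) (reOp Ω H) = reOp Λ H := by
  ext p q
  obtain ⟨p, rfl⟩ := (idxEquiv Λ).surjective p
  obtain ⟨q, rfl⟩ := (idxEquiv Λ).surjective q
  have ep : B4.inclIdx (N := 2) (chartSet_mono h) (idxEquiv Λ p) = idxEquiv Ω (⟨p.1.1, h p.1.2⟩, p.2) := rfl
  have eq : B4.inclIdx (N := 2) (chartSet_mono h) (idxEquiv Λ q) = idxEquiv Ω (⟨q.1.1, h q.1.2⟩, q.2) := rfl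
  rw [B4.compress, Matrix.submatrix_apply, ep, eq, reOp_apply, reOp_apply]
  rfl

/-- **(2.48) FOR THE CHARTED TORUS OPERATORS** — *"neither does C^{(k)}_{Λ,loc}(u; x₁, x₂) depend on Λ if dist({x₁, x₂}, Λ^c) > ½r(e_k) …
C^{(k)}_{loc}(u; x₁, x₂) = C^{(k)}_{Λ,loc}(u; x₁, x₂), Λ large enough. (2.48)"*: for `Λ₁, Λ₂ ⊆ Ω ⊆ T^{(k)}`, ANY operator `H`, cubes `M ≥ 1`,
radius `ρ`, and `x₁, x₂ ∈ Λ₁ ∩ Λ₂` (real components `i₁, i₂`) with `|x₁ − y|_chart > (ρ + 2)M` for every `y ∈ Ω ∖ Λ₁` and every `y ∈ Ω ∖ Λ₂`: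
the local parts of the walk expansions of `(H|_{Λ₁})^{−1}` and of `(H|_{Λ₂})^{−1}` (p13's `cLoc` of the charted operators `reOp Λ_i H`) at
`((x₁,i₁),(x₂,i₂))` COINCIDE — p13's `cLoc_eq_cLoc_of_far` BY NAME through `compress_reOp`. [cite: BalabanImbrieJaffe1988, (2.48) p.265] -/
theorem cLoc_reOp_eq_of_far {Λ₁ Λ₂ Ω : Finset (Balaban1983to89.Site P j)} (h₁ : Λ₁ ⊆ Ω) (h₂ : Λ₂ ⊆ Ω)
    (H : Matrix (Balaban1983to89.Site P j) (Balaban1983to89.Site P j) ℂ) {M : ℕ} (hM : 0 < M) (ρ : ℝ) (x₁ x₂ : ↥Ω × Fin 2)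
    (hx₁ : x₁.1.1 ∈ Λ₁) (hx₂ : x₂.1.1 ∈ Λ₁) (hx₁' : x₁.1.1 ∈ Λ₂) (hx₂' : x₂.1.1 ∈ Λ₂)
    (hfar₁ : ∀ y ∈ Ω, y ∉ Λ₁ → (ρ + 2) * M < cdist x₁.1.1 y) (hfar₂ : ∀ y ∈ Ω, y ∉ Λ₂ → (ρ + 2) * M < cdist x₁.1.1 y) :
    cLoc (ldist (N := 2) M) ρ (fun ω y₁ y₂ => latticeCw M (chartSet Λ₁) 2 (reOp Λ₁ H) ω y₁ y₂)
        (idxEquiv Λ₁ (⟨x₁.1.1, hx₁⟩, x₁.2)) (idxEquiv Λ₁ (⟨x₂.1.1, hx₂⟩, x₂.2)) =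
      cLoc (ldist (N := 2) M) ρ (fun ω y₁ y₂ => latticeCw M (chartSet Λ₂) 2 (reOp Λ₂ H) ω y₁ y₂)
        (idxEquiv Λ₂ (⟨x₁.1.1, hx₁'⟩, x₁.2)) (idxEquiv Λ₂ (⟨x₂.1.1, hx₂'⟩, x₂.2)) := by
  have key := cLoc_eq_cLoc_of_far (N := 2) hM (chartSet_mono h₁) (chartSet_mono h₂) (reOp Ω H) ρ (idxEquiv Ω x₁) (idxEquiv Ω x₂)
    (Finset.mem_map_of_mem chartEmb hx₁) (Finset.mem_map_of_mem chartEmb hx₂) (Finset.mem_map_of_mem chartEmb hx₁')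
    (Finset.mem_map_of_mem chartEmb hx₂') (farFromCompl_chart hfar₁) (farFromCompl_chart hfar₂)
  rw [compress_reOp h₁, compress_reOp h₂] at key
  exact key

/-- **(2.48), FIRST CLAUSE, FOR THE CHARTED TORUS OPERATORS** — *"If X does not intersect Λ₁ then C^{(k)}_{Λ,X}(u) does not depend on Λ"*:
for `Λ ⊆ Ω ⊆ T^{(k)}`, ANY `H`, cubes `M ≥ 1` grouped in `r(e_k)`-cubes of `s` labels, radius `ρ`, and a cube set `X` of the charted `Λ` with
p13's `XFar` (every label of the charted `Ω` whose cube touches `X` is a deep label of the charted `Λ`): the `X`-part of the walk expansion of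
`(H|_Ω)^{−1}` (with `X` pushed to `Ω`) at the included indices equals the `X`-part of `(H|_Λ)^{−1}` — p13's `cX_eq_of_far` BY NAME through
`compress_reOp`. [cite: BalabanImbrieJaffe1988, (2.48) p.265] -/
theorem cX_reOp_eq_of_far {Λ Ω : Finset (Balaban1983to89.Site P j)} (h : Λ ⊆ Ω)
    (H : Matrix (Balaban1983to89.Site P j) (Balaban1983to89.Site P j) ℂ) {M s : ℕ} (hM : 0 < M) (ρ : ℝ)
    {X : Finset (Cubes M s (chartSet Λ))} (hX : XFar M s (chartSet Ω) (chartSet Λ) X) (x₁ x₂ : B4.Idx (chartSet Λ) 2) :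
    cX (ldist (N := 2) M) ρ (cubeOf M s) touch (fun ω y₁ y₂ => latticeCw M (chartSet Ω) 2 (reOp Ω H) ω y₁ y₂)
        (X.image (eCube M s (chartSet_mono h))) (B4.inclIdx (chartSet_mono h) x₁) (B4.inclIdx (chartSet_mono h) x₂) =
      cX (ldist (N := 2) M) ρ (cubeOf M s) touch (fun ω y₁ y₂ => latticeCw M (chartSet Λ) 2 (reOp Λ H) ω y₁ y₂) X x₁ x₂ := by
  have key := cX_eq_of_far (N := 2) hM (chartSet_mono h) (reOp Ω H) ρ hX x₁ x₂
  rwa [compress_reOp h] at key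

end

end Literature.MathematicalPhysics.QuantumFieldTheory.BalabanImbrieJaffe1984to88.BIJ88Eq248HiggsCovarianceTorus
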